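import Literature.AlgebraicGeometry.Resolution.QuadraticTransformWeakTransform
import Literature.AlgebraicGeometry.Resolution.RegularLocalRingsQuotient
import Summits.ResolutionOfSingularities.ResolutionOfSingularities.Theorems.RadicialJungCleanModelsSubquotientLength
import Literature.RingTheory.HilbertSamuel.LocalRing
import Literature.RingTheory.HilbertSamuel.RegularLocalRing
import Mathlib.Algebra.Module.Submodule.Pointwise
import HarnessLib

/-!
# Route `RadicialJung`, crux `CleanModels` (stmt-15917): Giraud's Lemme 2.1.1 — the total colength
# of the weak transform over the whole exceptional fibre

Support file (OURS) for PROGRAMME-clean-dim2 (brick K2 (α) of `K2-DESIGN.md`, W8.1) of the crux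
`RadicialJung.CleanModels` (stmt-15917; line `via-clean-models` of `DescentPerfectToAll`): the
termination measure of a Giraud-type cleaning procedure on a regular surface rests on this lemma,
here proved WITHOUT any `F`-finiteness / excellence / residue-field hypothesis. J. Giraud, Bull.
SMF 111 (1983), Lemme 2.1.1 (p. 116): "Soit `X` un schéma régulier de dimension 2, soit `ξ` un
point fermé de `X` et soit `e : X′ → X` l'éclatement de `X` de centre `ξ`. Soit encore `I` un
idéal de `𝒪_X` et soit `I′ = I𝒪_{X′}`. Si on pose `m = m(I, ξ)`, on a
`Σ_{ξ′ ↦ ξ} [k(ξ′):k(ξ)] c(I′, ξ′) ≤ c(I, ξ) − m(m+1)/2`" — for `I` of finite colength and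
`m = ord_ξ I`, `c(I′, ξ′)` is the colength of the WEAK TRANSFORM at `ξ′` and the sum runs over
ALL closed points of the exceptional curve `E ≅ ℙ¹_{k(ξ)}`, weighted by residue degrees. Giraud's
proof: `R¹e_*(I′) = 0` since `I′` is generated by its sections, `B(I′) = 𝔐ᵐ𝒪_{X′}`,
`long 𝒪_ξ/𝔐ᵐ = m(m+1)/2`.

Here the lemma is proved in CHART ALGEBRA, inside the fraction field `K` of the two-dimensional
regular local ring `(R, 𝔪 = (x, y))` (the setting of `QuadraticTransformWeakTransform.lean`):
`A = R[y/x]` and `B = R[x/y]` are the two charts of `X′ = Bl_𝔪 Spec R`, `A + B = R[y/x, x/y]`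
their overlap (`toSubmodule_adjoin_pair_inv_eq_sup`), and for `J ⊆ 𝔪ʳ` the `R`-module
`𝔪ʳA/JA = xʳA/JA ≅ A/(JA : xʳ)` is the quotient of the chart by the weak transform
(`weakTransformChart`), whose `R`-LENGTH is the residue-degree-weighted sum of the colengths at the
points of the chart. PROVED, no definitions:

* `maximalIdeal_pow_smul_toSubmodule_adjoin` — `𝔪ʳA = xʳA` (as `R`-submodules of `K`);
* `pow_smul_adjoin_inf_pow_smul_adjoin_eq_map` — **`xʳA ∩ yʳB = 𝔪ʳ`** (`Γ(X′, 𝒪(-rE)) = 𝔪ʳ`;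
  `x` is a prime of `R` not dividing `y`, `prime_and_not_dvd_of_maximalIdeal_eq_span_pair`, and
  `xʳA ∩ R = 𝔪ʳ`, `comap_map_pow_maximalIdeal`);
* `length_quot_weakTransform_charts_add_le` — **GIRAUD 2.1.1, global algebraic form: for ANY
  ideal `J ⊆ 𝔪ʳ`,
  `λ_R(𝔪ʳA/JA) + λ_R(𝔪ʳB/JB) + λ_R(R/𝔪ʳ) ≤ λ_R(R/J) + λ_R(𝔪ʳ(A+B)/J(A+B))` in `ℕ∞`**
  (no finiteness, order or genericity hypothesis; for `r = ord J`, `J` `𝔪`-primary, every term is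
  finite and `λ(chart x) + λ(chart y) − λ(overlap)` is Giraud's weighted sum over `E`);
* `length_quotient_pow_maximalIdeal_eq` — `λ(R/𝔪ʳ) = r(r+1)/2` (CJS Lemma 2.23 summed);
* `length_quot_weakTransform_charts_add_choose_le` — the numerical form with `r(r+1)/2`.

Not here: the scheme-level packaging (points of `Bl_𝔪 Spec R`, sums over quadratic transforms);
one-chart `S`-length form: `length_quotient_transform_lt` (`QuadraticTransformColength.lean`).

## References
* [Giraud1983] J. Giraud, Forme normale d'une fonction sur une surface de caractéristique
  positive, Bull. Soc. Math. France 111 (1983), 109–124, Lemme 2.1.1 (p. 116).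
* [HunekeSwanson2006] C. Huneke, I. Swanson, Integral Closure of Ideals, Rings, and Modules,
  CUP 2006, §14.2 (p. 264), Lemma 14.3.4.
* [CossartJannsenSaito2020] V. Cossart, U. Jannsen, S. Saito, LNM 2270 (2020), Lemma 2.23.
* [Matsumura1987] H. Matsumura, Commutative Ring Theory, Thm. 14.3 (elements of `𝔪 ∖ 𝔪²` of a
  regular local ring are prime).

Nothing here is a statement of Hironaka's manuscript or bears on the summit directly.
-/

noncomputable section

set_option linter.dupNamespace false -- mandated namespace of this single-conjunct summit

open IsLocalRing Literature.AlgebraicGeometry.Resolution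

namespace Summit.ResolutionOfSingularities.ResolutionOfSingularities.Theorems.RadicialJung.CleanModels

universe u v

/-! ## The two charts of the blowing up of the closed point, inside the fraction field -/

section Charts

variable {K : Type u} [Field K]

/-- **`R[u, u⁻¹] = R[u] + R[u⁻¹]`** as `R`-submodules of a field (`u ≠ 0`): every monomial in
`u, u⁻¹` is an integer power of `u`. Applied to `u = y/x` this says that the coordinate ring of
the overlap of the two charts of the blowing up of `𝔪 = (x, y)` is the sum of the two chart rings.
[folklore] -/
theorem toSubmodule_adjoin_pair_inv_eq_sup {A : Type v} [CommRing A] [Algebra A K] {u : K}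
    (hu : u ≠ 0) :
    Subalgebra.toSubmodule (Algebra.adjoin A ({u, u⁻¹} : Set K)) =
      Subalgebra.toSubmodule (Algebra.adjoin A {u}) ⊔
        Subalgebra.toSubmodule (Algebra.adjoin A {u⁻¹}) := by
  refine le_antisymm ?_ (sup_le
    (Subalgebra.toSubmodule.monotone (Algebra.adjoin_mono (by simp)))
    (Subalgebra.toSubmodule.monotone (Algebra.adjoin_mono (by simp))))
  rw [Algebra.adjoin_eq_span, Submodule.span_le]
  intro w hw
  have key : ∃ n : ℤ, w = u ^ n := by
    induction hw using Submonoid.closure_induction with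
    | mem z hz =>
      rcases hz with rfl | rfl
      · exact ⟨1, (zpow_one _).symm⟩
      · exact ⟨-1, (zpow_neg_one _).symm⟩
    | one => exact ⟨0, (zpow_zero _).symm⟩
    | mul a b _ _ iha ihb =>
      obtain ⟨n, rfl⟩ := iha
      obtain ⟨m, rfl⟩ := ihb
      exact ⟨n + m, (zpow_add₀ hu n m).symm⟩
  obtain ⟨n, rfl⟩ := key
  obtain ⟨k, rfl | rfl⟩ := Int.eq_nat_or_neg n
  · rw [zpow_natCast]
    exact Submodule.mem_sup_left
      (Subalgebra.pow_mem _ (Algebra.subset_adjoin (Set.mem_singleton u)) k)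
  · rw [zpow_neg, zpow_natCast, ← inv_pow]
    exact Submodule.mem_sup_right
      (Subalgebra.pow_mem _ (Algebra.subset_adjoin (Set.mem_singleton u⁻¹)) k)

variable {R : Subring K}

/-- The image of an ideal `I` of `R` in `K` lies in `I · R[u]` (`i = i · 1`). [folklore] -/
theorem map_linearMap_le_smul_toSubmodule (I : Ideal R) (S : Subalgebra R K) :
    Submodule.map (Algebra.linearMap R K) I ≤ I • Subalgebra.toSubmodule S := by
  rintro _ ⟨i, hi, rfl⟩
  rw [Algebra.linearMap_apply, Algebra.algebraMap_eq_smul_one]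
  exact Submodule.smul_mem_smul hi (Subalgebra.one_mem S)

section Local

variable [IsLocalRing R] {x y : R}

/-- **`𝔪 · R[y/x] = x · R[y/x]`** for `𝔪 = (x, y)` (`y · a = x · ((y/x) a)`), as `R`-submodules
of `K`. [cite: HunekeSwanson2006, §14.2 (p. 264)] -/
theorem maximalIdeal_smul_toSubmodule_adjoin (hm : maximalIdeal R = Ideal.span {x, y})
    (hx0 : x ≠ 0) :
    maximalIdeal R • Subalgebra.toSubmodule (Algebra.adjoin R {((y : R) : K) / ((x : R) : K)}) =
      Ideal.span {x} •
        Subalgebra.toSubmodule (Algebra.adjoin R {((y : R) : K) / ((x : R) : K)}) := by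
  set u : K := ((y : R) : K) / ((x : R) : K) with hu
  set 𝒜 := Subalgebra.toSubmodule (Algebra.adjoin R {u})
  have hx0K : ((x : R) : K) ≠ 0 := fun e => hx0 (Subtype.ext e)
  have hxm : Ideal.span {x} ≤ maximalIdeal R := by
    rw [hm]; exact Ideal.span_mono (by simp)
  refine le_antisymm ?_ (Submodule.smul_mono_left hxm)
  rw [hm, Ideal.span_insert, Submodule.sup_smul]
  refine sup_le le_rfl (Submodule.smul_le.mpr fun c hc a ha => ?_)
  obtain ⟨d, rfl⟩ := Ideal.mem_span_singleton'.mp hc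
  have hua : d • (u * a) ∈ 𝒜 :=
    (Algebra.adjoin R {u}).smul_mem
      ((Algebra.adjoin R {u}).mul_mem (Algebra.subset_adjoin (Set.mem_singleton u)) ha) d
  have e : (d * y) • a = x • (d • (u * a)) := by
    simp only [Algebra.smul_def, Algebra.algebraMap_ofSubsemiring_apply, Subring.coe_mul, hu]
    field_simp
  rw [e]
  exact Submodule.smul_mem_smul (Ideal.mem_span_singleton_self x) hua

/-- **`𝔪ʳ · R[y/x] = xʳ · R[y/x]`** for `𝔪 = (x, y)`. [cite: HunekeSwanson2006, §14.2 (p. 264)] -/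
theorem maximalIdeal_pow_smul_toSubmodule_adjoin (hm : maximalIdeal R = Ideal.span {x, y})
    (hx0 : x ≠ 0) (r : ℕ) :
    maximalIdeal R ^ r •
        Subalgebra.toSubmodule (Algebra.adjoin R {((y : R) : K) / ((x : R) : K)}) =
      Ideal.span {x ^ r} •
        Subalgebra.toSubmodule (Algebra.adjoin R {((y : R) : K) / ((x : R) : K)}) := by
  induction r with
  | zero => rw [pow_zero, pow_zero, Ideal.one_eq_top, Ideal.span_singleton_one]
  | succ r ih =>
    rw [pow_succ', Submodule.mul_smul, ih, ← Submodule.mul_smul, mul_comm, Submodule.mul_smul,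
      maximalIdeal_smul_toSubmodule_adjoin hm hx0, ← Submodule.mul_smul,
      Ideal.span_singleton_mul_span_singleton, ← pow_succ]

omit [IsLocalRing R] in
/-- Membership in `xʳ · R[y/x]`: `z = xʳ a` with `a ∈ R[y/x]`. [folklore] -/
theorem mem_span_singleton_smul_toSubmodule_iff (t : R) (S : Subalgebra R K) (z : K) :
    z ∈ Ideal.span {t} • Subalgebra.toSubmodule S ↔ ∃ a ∈ S, ((t : R) : K) * a = z := by
  rw [Submodule.ideal_span_singleton_smul, Submodule.mem_smul_pointwise_iff_exists]
  simp only [Subalgebra.mem_toSubmodule, Algebra.smul_def, Algebra.algebraMap_ofSubsemiring_apply]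

end Local

section Regular

variable [IsRegularLocalRing R] {x y : R}

/-- For a regular system of parameters `(x, y)` of a two-dimensional regular local ring, `x` is a
prime element not dividing `y`. [cite: Matsumura1987, Thm. 14.3] -/
theorem prime_and_not_dvd_of_maximalIdeal_eq_span_pair (hdim : ringKrullDim R = 2)
    (hm : maximalIdeal R = Ideal.span {x, y}) : Prime x ∧ ¬ x ∣ y := by
  have hxm : x ∈ maximalIdeal R := hm ▸ Ideal.subset_span (by simp)
  refine ⟨IsRegularLocalRing.prime_of_not_mem_sq hxm (fst_not_mem_sq hdim hm), ?_⟩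
  rintro ⟨c, hc⟩
  apply maximalIdeal_ne_span_singleton hdim x
  rw [hm]
  refine le_antisymm ?_ (Ideal.span_mono (by simp))
  rw [Ideal.span_le]
  rintro z (rfl | rfl)
  · exact Ideal.mem_span_singleton_self _
  · rw [SetLike.mem_coe, hc]
    exact Ideal.mul_mem_right _ _ (Ideal.mem_span_singleton_self _)

/-- **`xʳ R[y/x] ∩ yʳ R[x/y] = 𝔪ʳ`** inside `K`, for a two-dimensional regular local ring
`(R, 𝔪 = (x, y))`: the sections of `𝒪(-rE)` over the two charts of the blowing up of the closed
point which agree on the overlap come from `𝔪ʳ` (`Γ(X′, 𝒪_{X′}(-rE)) = 𝔪ʳ`). If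
`z = xʳ a = yʳ b` with `xⁿ a = α ∈ 𝔪ⁿ`, `yˡ b = β ∈ 𝔪ˡ`, then `xⁿ ∣ xʳ α yˡ` in `R`, and `x` is a
prime not dividing `y`, so `z ∈ R`; then `z ∈ xʳ R[y/x] ∩ R = 𝔪ʳ` (`comap_map_pow_maximalIdeal`).
[cite: HunekeSwanson2006, §14.2 (p. 264)] -/
theorem pow_smul_adjoin_inf_pow_smul_adjoin_eq_map (hdim : ringKrullDim R = 2)
    (hm : maximalIdeal R = Ideal.span {x, y}) (r : ℕ) :
    maximalIdeal R ^ r •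
          Subalgebra.toSubmodule (Algebra.adjoin R {((y : R) : K) / ((x : R) : K)}) ⊓
        maximalIdeal R ^ r •
          Subalgebra.toSubmodule (Algebra.adjoin R {((x : R) : K) / ((y : R) : K)}) =
      Submodule.map (Algebra.linearMap R K) (maximalIdeal R ^ r) := by
  have hm' : maximalIdeal R = Ideal.span {y, x} := hm.trans Ideal.span_pair_comm
  -- `x ≠ 0`, `y ≠ 0` (as `x, y ∉ 𝔪²`; cf. `FolLU.GoodOfTop.fst_ne_zero`, stated for `K : Type`)
  have hx0 : x ≠ 0 := fun h => fst_not_mem_sq hdim hm (by rw [h]; exact Ideal.zero_mem _)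
  have hy0 : y ≠ 0 := fun h => fst_not_mem_sq hdim hm' (by rw [h]; exact Ideal.zero_mem _)
  have hx0K : ((x : R) : K) ≠ 0 := fun e => hx0 (Subtype.ext e)
  have hy0K : ((y : R) : K) ≠ 0 := fun e => hy0 (Subtype.ext e)
  obtain ⟨hxprime, hxy⟩ := prime_and_not_dvd_of_maximalIdeal_eq_span_pair hdim hm
  refine le_antisymm ?_ (le_inf (map_linearMap_le_smul_toSubmodule _ _)
    (map_linearMap_le_smul_toSubmodule _ _))
  intro z hz
  obtain ⟨hzA, hzB⟩ := Submodule.mem_inf.mp hz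
  rw [maximalIdeal_pow_smul_toSubmodule_adjoin hm hx0, mem_span_singleton_smul_toSubmodule_iff]
    at hzA
  rw [maximalIdeal_pow_smul_toSubmodule_adjoin hm' hy0, mem_span_singleton_smul_toSubmodule_iff]
    at hzB
  obtain ⟨a, ha, rfl⟩ := hzA
  obtain ⟨b, hb, hab⟩ := hzB
  simp only [Subring.coe_pow] at hab
  -- `xⁿ a = α ∈ 𝔪ⁿ`, `yˡ b = β ∈ 𝔪ˡ`
  obtain ⟨n, α, hα, hαa⟩ := exists_pow_mul_eq_chartIncl (K := K) hm hx0 ⟨a, ha⟩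
  obtain ⟨l, β, hβ, hβb⟩ := exists_pow_mul_eq_chartIncl (K := K) hm' hy0 ⟨b, hb⟩
  have hαK : ((α : R) : K) = ((x : R) : K) ^ n * a := by
    have := congrArg (fun t : chartAdjoin (K := K) x y => (t : K)) hαa
    simpa using this
  have hβK : ((β : R) : K) = ((y : R) : K) ^ l * b := by
    have := congrArg (fun t : chartAdjoin (K := K) y x => (t : K)) hβb
    simpa using this
  -- `xʳ α yˡ = xⁿ yʳ β` in `R`
  have hR : x ^ r * α * y ^ l = x ^ n * (y ^ r * β) := by
    apply Subtype.ext
    simp only [Subring.coe_mul, Subring.coe_pow, hαK, hβK]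
    linear_combination (((x : R) : K) ^ n * ((y : R) : K) ^ l) * hab.symm
  -- `xⁿ ∣ xʳ α`
  obtain ⟨w, hw⟩ : x ^ n ∣ x ^ r * α := hxprime.pow_dvd_of_dvd_mul_right (b := y ^ l) n
    (fun h => hxy (hxprime.dvd_of_dvd_pow h)) ⟨y ^ r * β, hR⟩
  -- so `z = xʳ a = w ∈ R`
  have hzw : ((x : R) : K) ^ r * a = ((w : R) : K) := by
    have e : ((x : R) : K) ^ n * (((x : R) : K) ^ r * a) = ((x : R) : K) ^ n * ((w : R) : K) := by
      have := congrArg (fun t : R => (t : K)) hw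
      simp only [Subring.coe_mul, Subring.coe_pow] at this
      rw [← this, hαK]
      ring
    exact mul_left_cancel₀ (pow_ne_zero n hx0K) e
  rw [Subring.coe_pow, hzw]
  refine ⟨w, ?_, rfl⟩
  show w ∈ maximalIdeal R ^ r
  -- and `w ∈ xʳ R[y/x] ∩ R = 𝔪ʳ`
  letI : Algebra R (chartAdjoin (K := K) x y) := (chartIncl x y).toAlgebra
  have halg : algebraMap R (chartAdjoin (K := K) x y) = chartIncl x y := rfl
  have hxm : x ∈ maximalIdeal R := hm ▸ Ideal.subset_span (by simp)
  have hmS : (maximalIdeal R).map (algebraMap R (chartAdjoin (K := K) x y)) =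
      Ideal.span {algebraMap R _ x} := map_maximalIdeal_chartIncl hm hx0
  rw [← comap_map_pow_maximalIdeal hxm (fst_not_mem_sq hdim hm) (chartIncl_injective x y) hmS
    (exists_pow_mul_eq_chartIncl (K := K) hm hx0) r, Ideal.mem_comap, Ideal.map_pow, hmS,
    Ideal.span_singleton_pow, Ideal.mem_span_singleton']
  refine ⟨⟨a, ha⟩, Subtype.ext ?_⟩
  rw [halg]
  simp only [Subring.coe_mul, Subring.coe_pow, Subring.coe_inclusion, mul_comm (a : K)]
  exact hzw

/-- **Giraud's Lemme 2.1.1 — the total colength of the weak transform over the whole exceptional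
fibre** (Giraud 1983, Lemme 2.1.1; Huneke–Swanson 2006, Lemma 14.3.4 for one chart). Let
`(R, 𝔪 = (x, y))` be a two-dimensional regular local subring of the field `K`, `J ⊆ 𝔪ʳ` any
ideal, `A = R[y/x]`, `B = R[x/y]` the two charts of the blowing up of the closed point and
`A + B = R[y/x, x/y]` their overlap (`toSubmodule_adjoin_pair_inv_eq_sup`). With all modules
taken as `R`-modules (so that lengths are weighted by residue degrees `[κ(ξ′) : κ]`):
`λ_R(𝔪ʳA/JA) + λ_R(𝔪ʳB/JB) + λ_R(R/𝔪ʳ) ≤ λ_R(R/J) + λ_R(𝔪ʳ(A+B)/J(A+B))`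
in `ℕ∞`. Here `𝔪ʳA/JA = xʳA/JA ≅ A/(JA : xʳ)` is the quotient by the weak transform; when
`r = ord J` and `J` is `𝔪`-primary all terms are finite and the statement reads
`Σ_{ξ′ ∈ E} [κ(ξ′):κ] λ(𝒪_{X′,ξ′}/J′) ≤ λ(R/J) − r(r+1)/2` (the sum over the points of the
exceptional curve `E` is `λ(chart x) + λ(chart y) − λ(overlap)`). Proof (Čech-free form of
Giraud's `R¹e_*(J𝒪_{X′}) = 0`): by `length_quot_add_length_quot_eq_inf_add_sup` the left two
terms equal `λ((𝔪ʳA ∩ 𝔪ʳB)/(JA ∩ JB)) + λ(overlap term)`, and `𝔪ʳA ∩ 𝔪ʳB = 𝔪ʳ`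
(`pow_smul_adjoin_inf_pow_smul_adjoin_eq_map`), `JA ∩ JB ⊇ J`, so the first is at most
`λ(𝔪ʳ/J) = λ(R/J) − λ(R/𝔪ʳ)`. [cite: Giraud1983, Lemme 2.1.1] -/
theorem length_quot_weakTransform_charts_add_le (hdim : ringKrullDim R = 2)
    (hm : maximalIdeal R = Ideal.span {x, y}) {J : Ideal R} {r : ℕ}
    (hJ : J ≤ maximalIdeal R ^ r) {𝒜 ℬ : Submodule R K}
    (h𝒜 : 𝒜 = Subalgebra.toSubmodule (Algebra.adjoin R {((y : R) : K) / ((x : R) : K)}))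
    (hℬ : ℬ = Subalgebra.toSubmodule (Algebra.adjoin R {((x : R) : K) / ((y : R) : K)})) :
    Module.length R (↥(maximalIdeal R ^ r • 𝒜) ⧸ (J • 𝒜).comap (maximalIdeal R ^ r • 𝒜).subtype) +
      Module.length R
        (↥(maximalIdeal R ^ r • ℬ) ⧸ (J • ℬ).comap (maximalIdeal R ^ r • ℬ).subtype) +
      Module.length R (R ⧸ maximalIdeal R ^ r) ≤
    Module.length R (R ⧸ J) +
      Module.length R (↥(maximalIdeal R ^ r • (𝒜 ⊔ ℬ)) ⧸
        (J • (𝒜 ⊔ ℬ)).comap (maximalIdeal R ^ r • (𝒜 ⊔ ℬ)).subtype) := by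
  have hA : J • 𝒜 ≤ maximalIdeal R ^ r • 𝒜 := Submodule.smul_mono_left hJ
  have hB : J • ℬ ≤ maximalIdeal R ^ r • ℬ := Submodule.smul_mono_left hJ
  have hI : maximalIdeal R ^ r • 𝒜 ⊓ maximalIdeal R ^ r • ℬ =
      Submodule.map (Algebra.linearMap R K) (maximalIdeal R ^ r) := by
    rw [h𝒜, hℬ]; exact pow_smul_adjoin_inf_pow_smul_adjoin_eq_map hdim hm r
  have hJ𝒜 : Submodule.map (Algebra.linearMap R K) J ≤ J • 𝒜 :=
    h𝒜 ▸ map_linearMap_le_smul_toSubmodule J _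
  have hJℬ : Submodule.map (Algebra.linearMap R K) J ≤ J • ℬ :=
    hℬ ▸ map_linearMap_le_smul_toSubmodule J _
  have key := length_quot_add_length_quot_eq_inf_add_sup hA hB hI rfl
    (Submodule.smul_sup _ _ _).symm (Submodule.smul_sup _ _ _).symm
  rw [key]
  -- `λ((𝔪ʳ)/(J𝒜 ∩ Jℬ)) ≤ λ(𝔪ʳ/J)`
  have hφ : Function.Injective (Algebra.linearMap R K) := Subtype.val_injective
  have h1 : Module.length R (↥(Submodule.map (Algebra.linearMap R K) (maximalIdeal R ^ r)) ⧸
      (J • 𝒜 ⊓ J • ℬ).comap (Submodule.map (Algebra.linearMap R K) (maximalIdeal R ^ r)).subtype) ≤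
      Module.length R (↥(maximalIdeal R ^ r) ⧸
        Submodule.comap (Submodule.subtype (maximalIdeal R ^ r)) J) := by
    refine (length_quot_comap_le_of_le _ (le_inf hJ𝒜 hJℬ)).trans ?_
    rw [length_quot_comap_map_eq (Algebra.linearMap R K) hφ hJ]
  have h2 := length_quot_comap_add_length_quotient (R := R) (V := R) hJ
  rw [add_right_comm, ← h2]
  exact add_le_add (add_le_add h1 le_rfl) le_rfl

end Regular

end Charts

section Length

variable {R : Type u} [CommRing R] [IsRegularLocalRing R]

open Literature.RingTheory.HilbertSamuel _root_.Finset in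
/-- **`λ_R(R/𝔪ʳ) = r(r+1)/2` for a two-dimensional regular local ring** (`ℓ(𝔪ⁱ/𝔪ⁱ⁺¹) = i + 1`,
CJS Lemma 2.23, summed). [cite: CossartJannsenSaito2020, Lemma 2.23] -/
theorem length_quotient_pow_maximalIdeal_eq (hdim : ringKrullDim R = 2) (r : ℕ) :
    Module.length R (R ⧸ maximalIdeal R ^ r) = ((r * (r + 1) / 2 : ℕ) : ℕ∞) := by
  -- adapted from `hilbertFun_eq_of_ringKrullDim_eq_two`
  -- (Summits/…/Theorems/ValuativeLuAlphaPTorsorColengthSharp.lean)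
  have hd : (maximalIdeal R).spanFinrank = 2 := by
    have h := IsRegularLocalRing.spanFinrank_maximalIdeal (R := R)
    rw [hdim] at h
    exact_mod_cast h
  have hH : ∀ i, hilbertFun R i = i + 1 := by
    intro i
    have h := length_gradedPiece_eq_hilbertFun R i
    rw [length_gradedPiece_of_isRegularLocalRing (n := i) (hd := hd),
      show i + 2 - 1 = i + 1 by omega, Nat.choose_succ_self_right] at h
    exact_mod_cast h.symm
  cases r with
  | zero =>
    rw [pow_zero, Ideal.one_eq_top]
    haveI : Subsingleton (R ⧸ (⊤ : Ideal R)) := Submodule.Quotient.subsingleton_iff.mpr rfl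
    rw [Module.length_eq_zero]
    simp
  | succ n =>
    rw [← sum_hilbertFun_eq_length R n]
    congr 1
    have hsum : ∀ m : ℕ, (∑ i ∈ range m, hilbertFun R i) * 2 = m * (m + 1) := by
      intro m
      induction m with
      | zero => simp
      | succ m ih => rw [sum_range_succ, add_mul, ih, hH]; ring
    have := hsum (n + 1)
    omega

end Length

section Final

variable {K : Type u} [Field K] {R : Subring K} [IsRegularLocalRing R] {x y : R}

/-- **Giraud's Lemme 2.1.1, numerical form**: with the notation of
`length_quot_weakTransform_charts_add_le`,
`λ_R(𝔪ʳA/JA) + λ_R(𝔪ʳB/JB) + r(r+1)/2 ≤ λ_R(R/J) + λ_R(𝔪ʳ(A+B)/J(A+B))` — i.e. for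
`r = ord J` and `J` of finite colength, the residue-degree-weighted colength of the weak
transform summed over all points of the exceptional curve is at most `λ(R/J) − r(r+1)/2`
(Giraud: `Σ_{ξ′ ↦ ξ} [k(ξ′):k(ξ)] c(I′, ξ′) ≤ c(I, ξ) − m(m+1)/2`).
[cite: Giraud1983, Lemme 2.1.1] -/
theorem length_quot_weakTransform_charts_add_choose_le (hdim : ringKrullDim R = 2)
    (hm : maximalIdeal R = Ideal.span {x, y}) {J : Ideal R} {r : ℕ}
    (hJ : J ≤ maximalIdeal R ^ r) {𝒜 ℬ : Submodule R K}
    (h𝒜 : 𝒜 = Subalgebra.toSubmodule (Algebra.adjoin R {((y : R) : K) / ((x : R) : K)}))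
    (hℬ : ℬ = Subalgebra.toSubmodule (Algebra.adjoin R {((x : R) : K) / ((y : R) : K)})) :
    Module.length R (↥(maximalIdeal R ^ r • 𝒜) ⧸ (J • 𝒜).comap (maximalIdeal R ^ r • 𝒜).subtype) +
      Module.length R
        (↥(maximalIdeal R ^ r • ℬ) ⧸ (J • ℬ).comap (maximalIdeal R ^ r • ℬ).subtype) +
      ((r * (r + 1) / 2 : ℕ) : ℕ∞) ≤
    Module.length R (R ⧸ J) +
      Module.length R (↥(maximalIdeal R ^ r • (𝒜 ⊔ ℬ)) ⧸
        (J • (𝒜 ⊔ ℬ)).comap (maximalIdeal R ^ r • (𝒜 ⊔ ℬ)).subtype) := by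
  rw [← length_quotient_pow_maximalIdeal_eq hdim r]
  exact length_quot_weakTransform_charts_add_le hdim hm hJ h𝒜 hℬ

end Final

end Summit.ResolutionOfSingularities.ResolutionOfSingularities.Theorems.RadicialJung.CleanModels

end
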